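import Mathlib
import HarnessLib

/-!
# The Fenchel conjugate: Fenchel–Young inequality, weak and strong Fenchel duality, polar cones
# and conjugate pairs on `ℝ` (Borwein–Zhu 2005, Ch. 4 §4.4)

A literature anchor for §4.4 *Fenchel Conjugate* of

* J. M. Borwein, Q. J. Zhu, *Techniques of Variational Analysis*, CMS Books in Mathematics 20,
  Springer 2005, Chapter 4 "Variational Techniques in Convex Analysis", §4.4, pp. 134–140
  [cite: BorweinZhu2005].

## Encoding (declared deviations from the printed text)

* `X` is a real normed space and `X*` is `X →L[ℝ] ℝ`.  The book works with functions
  `f : X → ℝ ∪ {+∞}`; here such a function is a real function `f : X → ℝ` together with its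
  effective domain `D = dom f ⊆ X` (only the values of `f` on `D` matter).  The indicator function
  `ι_C` of a set `C` is the pair `(C, 0)`.
* §4.4.1, p. 134: the **Fenchel conjugate** `f* : X* → [−∞, +∞]`,
  `f*(x*) = sup_{x ∈ dom f} {⟨x*, x⟩ − f(x)}`, is `fenchelConj D f : (X →L[ℝ] ℝ) → EReal`
  (values in Mathlib's extended reals `EReal = [−∞, +∞]`, `sup ∅ = ⊥`); its domain
  `dom f* = {x* | f*(x*) < +∞}` is `fenchelDom D f`.  The **biconjugate** is taken in `X` (as the
  book does for the bipolar, p. 136): `f**(x) = sup_{x*} {⟨x*, x⟩ − f*(x*)}` is `fenchelBiconj D f`.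
* Convexity of the extended-valued `f*` is stated as convexity of its epigraph
  (`convex_epigraph_fenchelConj`) and as `ConvexOn` of the real-valued restriction to `dom f*`
  (`convexOn_toReal_fenchelConj`).
* Proposition 4.4.1: the equality case `x* ∈ ∂f(x)` is written out by the book's definition
  (4.2.1) of the convex subdifferential, `∀ y ∈ dom f, ⟨x*, y − x⟩ ≤ f(y) − f(x)` (this is literally
  membership in `convexSubdiff D f x` of the sibling anchor `ConvexSubdifferentialMaxFormula`).
* Theorems 4.4.2/4.4.3: the Fenchel problems (4.4.2) are `fenchelPrimalValue` (`p`) and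
  `fenchelDualValue` (`d`), with the adjoint `A* y* = y* ∘ A` written `ys.comp A`.  Weak duality
  (Theorem 4.4.2) is proved in full.  Of the strong duality theorem (Theorem 4.4.3) we formalise
  exactly the printed deduction *from the conclusion (4.3.3) of the Decoupling Lemma 4.3.1*
  (`p ≤ [f(x) − ⟨y*, Ax⟩] + [g(y) + ⟨y*, y⟩]` for all `x, y`) to `p = d` with attainment at `y*`;
  the Decoupling Lemma itself (whose proof rests on Theorem 4.2.8, nonemptiness of the
  subdifferential, and on §4.1.3) is not repeated here, so the constraint qualifications
  (4.3.1)/(4.3.2) do not appear: they are replaced by the hypothesis (4.3.3) they imply.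
* Corollary 4.4.4: the weak duality inequality for linear constraints is proved; the equality
  statement (which needs Theorem 4.4.3 under (4.3.1)) is not formalised.  Corollary 4.4.5: the
  inclusion `K° + A*H° ⊆ (K ∩ A⁻¹H)°` is proved; the equality case is not formalised.
* The (negative) **polar cone** `K° = {x* | ⟨x*, x⟩ ≤ 0 ∀ x ∈ K}` (p. 136) is `negPolarCone K`, a
  subset of `X →L[ℝ] ℝ` (the tree's `polarCone` of `Literature.Analysis.Distribution` and `polar` of
  `Literature.Analysis.Convex.MoreauConeDecomposition` are inner-product versions living in the
  space itself, and Mathlib's `NormedSpace.polar` is the absolute polar `{x* | ‖x* x‖ ≤ 1}`; none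
  of them is used here), and `N(C; x) = (C − x)°` is `setOf_normal_eq_negPolarCone`.
* Neither Mathlib nor the tree has a general Fenchel conjugate (the tree's
  `Literature.Probability.Divergences.FDivVariational` takes a scalar conjugate pair satisfying the
  Fenchel–Young inequality as a hypothesis); all notions below are therefore defined here.
* Table 4.1 / Table 4.2 (p. 138, Exercise 4.4.2) concern convex functions on `ℝ`; for them the
  conjugate is written with the pairing `⟨y, x⟩ = x · y`,
  `realFenchelConj D f y = sup_{x ∈ D} (x y − f x)`, and `fenchelConj_eq_realFenchelConj` identifies
  it with `fenchelConj` on `X = ℝ`.  Rows formalised: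
  `f = 0` on `ℝ`, on `ℝ₊`, on `[−1, 1]`, on `[0, 1]`; `|x|^p / p` on `ℝ` (`1 < p`, conjugate
  `|y|^q / q`); `−log x` on `int ℝ₊`; `eˣ` on `ℝ` — together with the checks `f = f**` for the rows
  `eˣ` (the conjugate of `y log y − y` on `ℝ₊` is `eˣ`) and `f = 0` on `[−1, 1]` (the conjugate of
  `|y|` is `ι_[−1,1]`); and the three transformation rules of Table 4.2.  The rows
  `−x^p / p (0 < p < 1)` and `|x|^p / p` on `ℝ₊` are not formalised.
* NOT formalised: Exercises 4.4.3, 4.4.4, 4.4.7, 4.4.8, the equality parts of Exercise 4.4.9 and of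
  Exercise 4.4.11 (ii)–(v).

## Main statements

* `fenchel_young`, `fenchel_young_eq_iff` — Proposition 4.4.1 (Fenchel–Young inequality and its
  equality case), p. 135; `fenchelBiconj_le` (`f** ≤ f`).
* `convex_epigraph_fenchelConj`, `convexOn_toReal_fenchelConj`, `fenchelConj_anti`,
  `bot_lt_fenchelConj` — §4.4.1, p. 134 (`f*` is convex, order reversing, never `−∞` on a nonempty
  domain).
* `fenchelDualObjective_le`, `fenchel_weak_duality` — Theorem 4.4.2 (Fenchel weak duality), p. 135.
* `coe_le_fenchelDualObjective_of_decoupling`, `fenchel_strong_duality_of_decoupling` —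
  Theorem 4.4.3 (Fenchel duality: `p = d` and attainment) from (4.3.3), p. 136.
* `linearConstraints_weak_duality` — Corollary 4.4.4 (weak duality for linear constraints), p. 136.
* `negPolarCone`, `setOf_normal_eq_negPolarCone`, `add_comp_mem_negPolarCone_inter`,
  `negPolarCone_add_image_subset` — polar cone, `N(C; x) = (C − x)°`, Corollary 4.4.5, pp. 136–137.
* `fenchelConj_indicator` (`ι_C* = σ_C`), `fenchelBiconj_indicator_of_mem`,
  `fenchelBiconj_indicator_of_not_mem` (`ι_C** = ι_C` for closed convex `C`, via the Hahn–Banach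
  separation theorem) — Exercise 4.4.6, p. 139.
* `concaveConj`, `concaveConj_sub_fenchelConj_le` — Exercise 4.4.9 (symmetric weak duality), p. 139.
* `fenchelConj_indicator_cone_of_mem`, `fenchelConj_indicator_cone_of_not_mem` — Exercise 4.4.10
  (`ι_K* = ι_{K°}`), p. 139; `negPolarCone_add` — Exercise 4.4.11 (i), p. 140.
* `realFenchelConj_zero_univ`, `realFenchelConj_zero_Ici`, `realFenchelConj_zero_Icc`,
  `realFenchelConj_zero_unitIcc`, `realFenchelConj_abs_rpow`, `realFenchelConj_neg_log`,
  `realFenchelConj_exp`, `realFenchelConj_mul_log_sub`, `realFenchelConj_abs`,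
  `realFenchelConj_comp_mul`, `realFenchelConj_comp_add`, `realFenchelConj_const_mul` — Tables 4.1
  and 4.2, p. 138 (Exercise 4.4.2).
-/

open Set Filter Topology
open scoped Pointwise

namespace Literature.Analysis.Convex.FenchelConjugate

variable {X : Type*} [NormedAddCommGroup X] [NormedSpace ℝ X]
variable {Y : Type*} [NormedAddCommGroup Y] [NormedSpace ℝ Y]

section Conjugate

/-! ### §4.4.1 The Fenchel conjugate -/

/-- The **Fenchel conjugate** `f*(x*) = sup_{x ∈ dom f} {⟨x*, x⟩ − f(x)} ∈ [−∞, +∞]` of a function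
`f` with effective domain `D`. [cite: BorweinZhu2005, §4.4.1 p. 134] -/
noncomputable def fenchelConj (D : Set X) (f : X → ℝ) (xs : X →L[ℝ] ℝ) : EReal :=
  ⨆ x ∈ D, ((xs x - f x : ℝ) : EReal)

/-- The domain `dom f* = {x* ∈ X* | f*(x*) < +∞}` of the conjugate.
[cite: BorweinZhu2005, §4.4.1 p. 134] -/
def fenchelDom (D : Set X) (f : X → ℝ) : Set (X →L[ℝ] ℝ) :=
  {xs | fenchelConj D f xs < ⊤}

variable {D D₁ D₂ : Set X} {f g : X → ℝ} {xs : X →L[ℝ] ℝ} {x : X}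

/-- Each `⟨x*, x⟩ − f(x)`, `x ∈ dom f`, lies below `f*(x*)`.
[cite: BorweinZhu2005, §4.4.1 p. 134] -/
theorem le_fenchelConj (xs : X →L[ℝ] ℝ) (hx : x ∈ D) :
    ((xs x - f x : ℝ) : EReal) ≤ fenchelConj D f xs :=
  le_iSup₂ (f := fun x (_ : x ∈ D) => ((xs x - f x : ℝ) : EReal)) x hx

/-- `f*(x*) ≤ c` iff `c` bounds every `⟨x*, x⟩ − f(x)`. [cite: BorweinZhu2005, §4.4.1 p. 134] -/
theorem fenchelConj_le_iff {c : EReal} :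
    fenchelConj D f xs ≤ c ↔ ∀ x ∈ D, ((xs x - f x : ℝ) : EReal) ≤ c :=
  iSup₂_le_iff

/-- Real upper bounds of `f*(x*)`. [cite: BorweinZhu2005, §4.4.1 p. 134] -/
theorem fenchelConj_le_coe_iff {c : ℝ} :
    fenchelConj D f xs ≤ (c : EReal) ↔ ∀ x ∈ D, xs x - f x ≤ c := by
  simp only [fenchelConj_le_iff, EReal.coe_le_coe_iff]

/-- Real strict lower bounds of `f*(x*)`. [cite: BorweinZhu2005, §4.4.1 p. 134] -/
theorem coe_lt_fenchelConj_iff {r : ℝ} :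
    (r : EReal) < fenchelConj D f xs ↔ ∃ x ∈ D, r < xs x - f x := by
  simp only [fenchelConj, lt_biSup_iff, EReal.coe_lt_coe_iff]

/-- `f*(x*) = +∞` iff the values `⟨x*, x⟩ − f(x)` are unbounded above.
[cite: BorweinZhu2005, §4.4.1 p. 134] -/
theorem fenchelConj_eq_top_iff :
    fenchelConj D f xs = ⊤ ↔ ∀ r : ℝ, ∃ x ∈ D, r < xs x - f x := by
  simp only [EReal.eq_top_iff_forall_lt, coe_lt_fenchelConj_iff]

/-- The conjugate of the function with empty domain (`f ≡ +∞`) is `−∞`.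
[cite: BorweinZhu2005, §4.4.1 p. 134] -/
theorem fenchelConj_empty (f : X → ℝ) (xs : X →L[ℝ] ℝ) : fenchelConj ∅ f xs = ⊥ := by
  simp [fenchelConj]

/-- If `dom f ≠ ∅` then `f*` never takes the value `−∞`. [cite: BorweinZhu2005, §4.4.1 p. 134] -/
theorem bot_lt_fenchelConj (hD : D.Nonempty) (f : X → ℝ) (xs : X →L[ℝ] ℝ) :
    ⊥ < fenchelConj D f xs := by
  obtain ⟨x, hx⟩ := hD
  exact lt_of_lt_of_le (EReal.bot_lt_coe _) (le_fenchelConj xs hx)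

/-- The conjugacy operation is order reversing: `f ≥ g` (i.e. `dom f ⊆ dom g` and `g ≤ f` on
`dom f`) implies `f* ≤ g*`. [cite: BorweinZhu2005, §4.4.1 p. 134] -/
theorem fenchelConj_anti (hD : D₁ ⊆ D₂) (hfg : ∀ x ∈ D₁, g x ≤ f x) (xs : X →L[ℝ] ℝ) :
    fenchelConj D₁ f xs ≤ fenchelConj D₂ g xs := by
  refine fenchelConj_le_iff.2 fun x hx => le_trans ?_ (le_fenchelConj xs (hD hx))
  exact EReal.coe_le_coe_iff.2 (by linarith [hfg x hx])

/-- Membership in `dom f*`: the values `⟨x*, x⟩ − f(x)` are bounded above.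
[cite: BorweinZhu2005, §4.4.1 p. 134] -/
theorem mem_fenchelDom_iff : xs ∈ fenchelDom D f ↔ ∃ c : ℝ, ∀ x ∈ D, xs x - f x ≤ c := by
  constructor
  · intro h
    by_contra hne
    push Not at hne
    refine (ne_of_lt h) (fenchelConj_eq_top_iff.2 fun r => ?_)
    obtain ⟨x, hx, hlt⟩ := hne r
    exact ⟨x, hx, hlt⟩
  · rintro ⟨c, hc⟩
    exact lt_of_le_of_lt (fenchelConj_le_coe_iff.2 hc) (EReal.coe_lt_top c)

/-- On a nonempty domain, `f*(x*)` is a real number for `x* ∈ dom f*`.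
[cite: BorweinZhu2005, §4.4.1 p. 134] -/
theorem fenchelConj_eq_coe_toReal (hD : D.Nonempty) (hxs : xs ∈ fenchelDom D f) :
    fenchelConj D f xs = ((fenchelConj D f xs).toReal : EReal) :=
  (EReal.coe_toReal (ne_of_lt hxs) (ne_of_gt (bot_lt_fenchelConj hD f xs))).symm

/-- For `x* ∈ dom f*` every `⟨x*, x⟩ − f(x)` is at most the real number `f*(x*)`.
[cite: BorweinZhu2005, §4.4.1 p. 134] -/
theorem sub_le_toReal_fenchelConj (hxs : xs ∈ fenchelDom D f) (hx : x ∈ D) :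
    xs x - f x ≤ (fenchelConj D f xs).toReal := by
  have h := le_fenchelConj (f := f) xs hx
  rw [fenchelConj_eq_coe_toReal ⟨x, hx⟩ hxs, EReal.coe_le_coe_iff] at h
  exact h

/-- If the supremum is attained at `x ∈ dom f` then `f*(x*) = ⟨x*, x⟩ − f(x)`.
[cite: BorweinZhu2005, §4.4.1 p. 134] -/
theorem fenchelConj_eq_coe_of_mem (hx : x ∈ D) (hmax : ∀ y ∈ D, xs y - f y ≤ xs x - f x) :
    fenchelConj D f xs = ((xs x - f x : ℝ) : EReal) :=
  le_antisymm (fenchelConj_le_coe_iff.2 hmax) (le_fenchelConj xs hx)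

/-- **`f*` is convex** (as an extended-valued function: its epigraph is convex).
[cite: BorweinZhu2005, §4.4.1 p. 134] -/
theorem convex_epigraph_fenchelConj (D : Set X) (f : X → ℝ) :
    Convex ℝ {q : (X →L[ℝ] ℝ) × ℝ | fenchelConj D f q.1 ≤ (q.2 : EReal)} := by
  intro q₁ h₁ q₂ h₂ a b ha hb hab
  simp only [mem_setOf_eq, fenchelConj_le_coe_iff] at h₁ h₂ ⊢
  intro x hx
  simp only [Prod.fst_add, Prod.snd_add, Prod.smul_fst, Prod.smul_snd, smul_eq_mul,
    add_apply, smul_apply]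
  have e : f x = a * f x + b * f x := by rw [← add_mul, hab, one_mul]
  nlinarith [mul_le_mul_of_nonneg_left (h₁ x hx) ha, mul_le_mul_of_nonneg_left (h₂ x hx) hb]

/-- `dom f*` is convex. [cite: BorweinZhu2005, §4.4.1 p. 134] -/
theorem convex_fenchelDom (D : Set X) (f : X → ℝ) : Convex ℝ (fenchelDom D f) := by
  intro xs₁ h₁ xs₂ h₂ a b ha hb hab
  obtain ⟨c₁, hc₁⟩ := mem_fenchelDom_iff.1 h₁
  obtain ⟨c₂, hc₂⟩ := mem_fenchelDom_iff.1 h₂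
  have h := convex_epigraph_fenchelConj D f (x := (xs₁, c₁)) (y := (xs₂, c₂))
    (fenchelConj_le_coe_iff.2 hc₁) (fenchelConj_le_coe_iff.2 hc₂) ha hb hab
  simp only [mem_setOf_eq, Prod.fst_add, Prod.snd_add, Prod.smul_fst, Prod.smul_snd,
    smul_eq_mul] at h
  exact lt_of_le_of_lt h (EReal.coe_lt_top _)

/-- **`f*` is convex**: on a nonempty `dom f`, the real-valued `f*` is convex on `dom f*`.
[cite: BorweinZhu2005, §4.4.1 p. 134] -/
theorem convexOn_toReal_fenchelConj (hD : D.Nonempty) (f : X → ℝ) :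
    ConvexOn ℝ (fenchelDom D f) fun xs => (fenchelConj D f xs).toReal := by
  refine ⟨convex_fenchelDom D f, fun xs₁ h₁ xs₂ h₂ a b ha hb hab => ?_⟩
  have hmem : a • xs₁ + b • xs₂ ∈ fenchelDom D f := convex_fenchelDom D f h₁ h₂ ha hb hab
  have hle : fenchelConj D f (a • xs₁ + b • xs₂) ≤
      ((a * (fenchelConj D f xs₁).toReal + b * (fenchelConj D f xs₂).toReal : ℝ) : EReal) := by
    refine fenchelConj_le_coe_iff.2 fun x hx => ?_
    simp only [add_apply, smul_apply,
      smul_eq_mul]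
    have e : f x = a * f x + b * f x := by rw [← add_mul, hab, one_mul]
    nlinarith [mul_le_mul_of_nonneg_left (sub_le_toReal_fenchelConj h₁ hx) ha,
      mul_le_mul_of_nonneg_left (sub_le_toReal_fenchelConj h₂ hx) hb]
  have h := EReal.toReal_le_toReal hle (ne_of_gt (bot_lt_fenchelConj hD f _))
    (EReal.coe_ne_top _)
  simpa only [EReal.toReal_coe, smul_eq_mul] using h

/-- The **biconjugate** taken in `X`: `f**(x) = sup_{x* ∈ X*} {⟨x*, x⟩ − f*(x*)}`.
[cite: BorweinZhu2005, §4.4.1 p. 134] -/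
noncomputable def fenchelBiconj (D : Set X) (f : X → ℝ) (x : X) : EReal :=
  ⨆ xs : X →L[ℝ] ℝ, (((xs x : ℝ) : EReal) - fenchelConj D f xs)

/-- Each `⟨x*, x⟩ − f*(x*)` lies below `f**(x)`. [cite: BorweinZhu2005, §4.4.1 p. 134] -/
theorem le_fenchelBiconj (xs : X →L[ℝ] ℝ) (x : X) :
    ((xs x : ℝ) : EReal) - fenchelConj D f xs ≤ fenchelBiconj D f x :=
  le_iSup (fun xs : X →L[ℝ] ℝ => ((xs x : ℝ) : EReal) - fenchelConj D f xs) xs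

end Conjugate

section FenchelYoung

/-! ### §4.4.2 The Fenchel–Young inequality (Proposition 4.4.1) -/

variable {D : Set X} {f : X → ℝ} {x : X}

/-- **Proposition 4.4.1 (Fenchel–Young inequality)**: for `x ∈ dom f` and `x* ∈ X*`,
`f(x) + f*(x*) ≥ ⟨x*, x⟩`. [cite: BorweinZhu2005, Prop 4.4.1 (4.4.1) p. 135] -/
theorem fenchel_young (hx : x ∈ D) (xs : X →L[ℝ] ℝ) :
    ((xs x : ℝ) : EReal) ≤ (f x : EReal) + fenchelConj D f xs := by
  have h := le_fenchelConj (f := f) xs hx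
  calc ((xs x : ℝ) : EReal) = (f x : EReal) + ((xs x - f x : ℝ) : EReal) := by
        rw [← EReal.coe_add]; congr 1; ring
    _ ≤ (f x : EReal) + fenchelConj D f xs := add_le_add le_rfl h

/-- Fenchel–Young inequality, real form on `dom f*`: `⟨x*, x⟩ ≤ f(x) + f*(x*)`.
[cite: BorweinZhu2005, Prop 4.4.1 (4.4.1) p. 135] -/
theorem fenchel_young_real {xs : X →L[ℝ] ℝ} (hx : x ∈ D) (hxs : xs ∈ fenchelDom D f) :
    xs x ≤ f x + (fenchelConj D f xs).toReal := by
  linarith [sub_le_toReal_fenchelConj hxs hx]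

/-- **`f** ≤ f`** on `dom f` (from the Fenchel–Young inequality).
[cite: BorweinZhu2005, Prop 4.4.1 p. 135; §4.4.1 p. 134] -/
theorem fenchelBiconj_le (hx : x ∈ D) : fenchelBiconj D f x ≤ (f x : EReal) :=
  iSup_le fun xs => EReal.sub_le_of_le_add (fenchel_young hx xs)

/-- **Proposition 4.4.1, equality case**, in the form `f*(x*) = ⟨x*, x⟩ − f(x)` iff `x* ∈ ∂f(x)`
(definition (4.2.1): `⟨x*, y − x⟩ ≤ f(y) − f(x)` for all `y ∈ dom f`).
[cite: BorweinZhu2005, Prop 4.4.1 p. 135] -/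
theorem fenchelConj_eq_iff_subgradient (hx : x ∈ D) (xs : X →L[ℝ] ℝ) :
    fenchelConj D f xs = ((xs x - f x : ℝ) : EReal) ↔ ∀ y ∈ D, xs (y - x) ≤ f y - f x := by
  constructor
  · intro h y hy
    have hy' := le_fenchelConj (f := f) xs hy
    rw [h, EReal.coe_le_coe_iff] at hy'
    rw [map_sub]; linarith
  · intro h
    refine fenchelConj_eq_coe_of_mem hx fun y hy => ?_
    have := h y hy; rw [map_sub] at this; linarith

/-- **Proposition 4.4.1 (Fenchel–Young inequality), equality case**: `f(x) + f*(x*) = ⟨x*, x⟩`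
if and only if `x* ∈ ∂f(x)`. [cite: BorweinZhu2005, Prop 4.4.1 p. 135] -/
theorem fenchel_young_eq_iff (hx : x ∈ D) (xs : X →L[ℝ] ℝ) :
    (f x : EReal) + fenchelConj D f xs = xs x ↔ ∀ y ∈ D, xs (y - x) ≤ f y - f x := by
  rw [← fenchelConj_eq_iff_subgradient hx xs]
  constructor
  · intro h
    have h' : (f x : EReal) + fenchelConj D f xs - (f x : EReal) = (xs x : EReal) - f x := by
      rw [h]
    rwa [EReal.add_sub_cancel_left, ← EReal.coe_sub] at h'
  · intro h
    rw [h, ← EReal.coe_add]; congr 1; ring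

end FenchelYoung

section Duality

/-! ### §4.4.3–§4.4.4 Weak and strong Fenchel duality (Theorems 4.4.2, 4.4.3, Corollary 4.4.4) -/

variable {Df : Set X} {f : X → ℝ} {Dg : Set Y} {g : Y → ℝ} {A : X →L[ℝ] Y}

/-- The primal value `p = inf_{x ∈ X} {f(x) + g(Ax)}` of the Fenchel problems (4.4.2).
[cite: BorweinZhu2005, Thm 4.4.2 (4.4.2) p. 135] -/
noncomputable def fenchelPrimalValue (Df : Set X) (f : X → ℝ) (Dg : Set Y) (g : Y → ℝ)
    (A : X →L[ℝ] Y) : EReal :=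
  ⨅ x ∈ {x ∈ Df | A x ∈ Dg}, ((f x + g (A x) : ℝ) : EReal)

/-- The dual value `d = sup_{y* ∈ Y*} {−f*(A*y*) − g*(−y*)}` of the Fenchel problems (4.4.2).
[cite: BorweinZhu2005, Thm 4.4.2 (4.4.2) p. 135] -/
noncomputable def fenchelDualValue (Df : Set X) (f : X → ℝ) (Dg : Set Y) (g : Y → ℝ)
    (A : X →L[ℝ] Y) : EReal :=
  ⨆ ys : Y →L[ℝ] ℝ, (-fenchelConj Df f (ys.comp A) - fenchelConj Dg g (-ys))

/-- The dual objective at any `y*` lies below the primal objective at any feasible `x`.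
[cite: BorweinZhu2005, Thm 4.4.2 p. 135] -/
theorem fenchelDualObjective_le {x : X} (hx : x ∈ Df) (hAx : A x ∈ Dg) (ys : Y →L[ℝ] ℝ) :
    -fenchelConj Df f (ys.comp A) - fenchelConj Dg g (-ys) ≤ ((f x + g (A x) : ℝ) : EReal) := by
  have h₁ := le_fenchelConj (f := f) (ys.comp A) hx
  have h₂ := le_fenchelConj (f := g) (-ys) hAx
  simp only [ContinuousLinearMap.comp_apply,
    neg_apply] at h₁ h₂
  have h₁' : -fenchelConj Df f (ys.comp A) ≤ ((-(ys (A x) - f x) : ℝ) : EReal) := by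
    rw [EReal.coe_neg]; exact EReal.neg_le_neg_iff.2 h₁
  calc -fenchelConj Df f (ys.comp A) - fenchelConj Dg g (-ys)
      ≤ ((-(ys (A x) - f x) : ℝ) : EReal) - ((-ys (A x) - g (A x) : ℝ) : EReal) :=
        EReal.sub_le_sub h₁' h₂
    _ = ((f x + g (A x) : ℝ) : EReal) := by rw [← EReal.coe_sub]; congr 1; ring

/-- **Theorem 4.4.2 (Fenchel weak duality)**: `p ≥ d`. [cite: BorweinZhu2005, Thm 4.4.2 p. 135] -/
theorem fenchel_weak_duality (Df : Set X) (f : X → ℝ) (Dg : Set Y) (g : Y → ℝ) (A : X →L[ℝ] Y) :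
    fenchelDualValue Df f Dg g A ≤ fenchelPrimalValue Df f Dg g A :=
  iSup_le fun ys => le_iInf₂ fun _ hx => fenchelDualObjective_le hx.1 hx.2 ys

/-- **Theorem 4.4.3 (Fenchel duality), the step from (4.3.3)**: if `y* ∈ Y*` satisfies the
conclusion `p ≤ [f(x) − ⟨y*, Ax⟩] + [g(y) + ⟨y*, y⟩]` (all `x ∈ dom f`, `y ∈ dom g`) of the
Decoupling Lemma 4.3.1, then `p ≤ −f*(A*y*) − g*(−y*)`.
[cite: BorweinZhu2005, Thm 4.4.3 p. 136 (proof)] -/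
theorem coe_le_fenchelDualObjective_of_decoupling (hDf : Df.Nonempty) (hDg : Dg.Nonempty) {p : ℝ}
    {ys : Y →L[ℝ] ℝ} (hdec : ∀ x ∈ Df, ∀ y ∈ Dg, p ≤ (f x - ys (A x)) + (g y + ys y)) :
    (p : EReal) ≤ -fenchelConj Df f (ys.comp A) - fenchelConj Dg g (-ys) := by
  obtain ⟨x₀, hx₀⟩ := hDf
  obtain ⟨y₀, hy₀⟩ := hDg
  -- both conjugates are finite
  have hF : ys.comp A ∈ fenchelDom Df f := by
    refine mem_fenchelDom_iff.2 ⟨g y₀ + ys y₀ - p, fun x hx => ?_⟩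
    have := hdec x hx y₀ hy₀
    simp only [ContinuousLinearMap.comp_apply]; linarith
  have hG : -ys ∈ fenchelDom Dg g := by
    refine mem_fenchelDom_iff.2 ⟨f x₀ - ys (A x₀) - p, fun y hy => ?_⟩
    have := hdec x₀ hx₀ y hy
    simp only [neg_apply]; linarith
  set F := (fenchelConj Df f (ys.comp A)).toReal with hFdef
  set G := (fenchelConj Dg g (-ys)).toReal with hGdef
  have eF := fenchelConj_eq_coe_toReal ⟨x₀, hx₀⟩ hF
  have eG := fenchelConj_eq_coe_toReal ⟨y₀, hy₀⟩ hG
  -- `G ≤ -p - F`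
  have hGle : G ≤ -p - F := by
    have h1 : fenchelConj Dg g (-ys) ≤ ((-p - F : ℝ) : EReal) := by
      refine fenchelConj_le_coe_iff.2 fun y hy => ?_
      simp only [neg_apply]
      -- `F ≤ -p + g y + ys y`
      have h2 : fenchelConj Df f (ys.comp A) ≤ ((g y + ys y - p : ℝ) : EReal) := by
        refine fenchelConj_le_coe_iff.2 fun x hx => ?_
        have := hdec x hx y hy
        simp only [ContinuousLinearMap.comp_apply]; linarith
      rw [eF, EReal.coe_le_coe_iff] at h2
      linarith
    rw [eG, EReal.coe_le_coe_iff] at h1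
    exact h1
  rw [eF, eG, ← EReal.coe_neg, ← EReal.coe_sub, EReal.coe_le_coe_iff]
  linarith

/-- **Theorem 4.4.3 (Fenchel duality)**, from (4.3.3): if the primal value `p` is finite and some
`y* ∈ Y*` satisfies the conclusion (4.3.3) of the Decoupling Lemma 4.3.1, then `p = d` and `y*`
attains the supremum in the dual problem (4.4.2). [cite: BorweinZhu2005, Thm 4.4.3 p. 136] -/
theorem fenchel_strong_duality_of_decoupling {p : ℝ} {ys : Y →L[ℝ] ℝ}
    (hp : IsGLB ((fun x => f x + g (A x)) '' {x ∈ Df | A x ∈ Dg}) p)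
    (hdec : ∀ x ∈ Df, ∀ y ∈ Dg, p ≤ (f x - ys (A x)) + (g y + ys y)) :
    fenchelPrimalValue Df f Dg g A = p ∧ fenchelDualValue Df f Dg g A = p ∧
      -fenchelConj Df f (ys.comp A) - fenchelConj Dg g (-ys) = p := by
  -- the feasible set is nonempty (an empty set has no greatest lower bound in `ℝ`)
  have hne : ({x ∈ Df | A x ∈ Dg}).Nonempty := by
    by_contra h
    rw [not_nonempty_iff_eq_empty] at h
    have h1 : p + 1 ∈ lowerBounds ((fun x => f x + g (A x)) '' {x ∈ Df | A x ∈ Dg}) := by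
      rw [h, image_empty]; exact fun _ h => h.elim
    linarith [hp.2 h1]
  obtain ⟨x₁, hx₁⟩ := hne
  have hprimal : fenchelPrimalValue Df f Dg g A = p := by
    apply le_antisymm
    · -- `primal ≤ p`: otherwise a real strictly between is a better lower bound
      by_contra hlt
      push Not at hlt
      obtain ⟨r, hpr, hr⟩ := EReal.lt_iff_exists_real_btwn.1 hlt
      have hr' : r ∈ lowerBounds ((fun x => f x + g (A x)) '' {x ∈ Df | A x ∈ Dg}) := by
        rintro _ ⟨x, hx, rfl⟩
        have := lt_of_lt_of_le hr (iInf₂_le (f := fun x (_ : x ∈ {x ∈ Df | A x ∈ Dg}) =>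
          ((f x + g (A x) : ℝ) : EReal)) x hx)
        exact (EReal.coe_lt_coe_iff.1 this).le
      exact absurd (hp.2 hr') (not_le.2 (EReal.coe_lt_coe_iff.1 hpr))
    · refine le_iInf₂ fun x hx => EReal.coe_le_coe_iff.2 (hp.1 ⟨x, hx, rfl⟩)
  have hobj : (p : EReal) ≤ -fenchelConj Df f (ys.comp A) - fenchelConj Dg g (-ys) :=
    coe_le_fenchelDualObjective_of_decoupling ⟨x₁, hx₁.1⟩ ⟨A x₁, hx₁.2⟩ hdec
  have hdual_le : fenchelDualValue Df f Dg g A ≤ p := hprimal ▸ fenchel_weak_duality Df f Dg g A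
  have hobj_le : -fenchelConj Df f (ys.comp A) - fenchelConj Dg g (-ys) ≤
      fenchelDualValue Df f Dg g A :=
    le_iSup (fun ys : Y →L[ℝ] ℝ => -fenchelConj Df f (ys.comp A) - fenchelConj Dg g (-ys)) ys
  exact ⟨hprimal, le_antisymm hdual_le (le_trans hobj hobj_le),
    le_antisymm (le_trans hobj_le hdual_le) hobj⟩

/-- **Corollary 4.4.4 (Fenchel duality for linear constraints), weak duality inequality**:
`inf {f(x) | Ax = b} ≥ sup_{y*} {⟨b, y*⟩ − f*(A*y*)}`, pointwise.
[cite: BorweinZhu2005, Cor 4.4.4 p. 136] -/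
theorem linearConstraints_weak_duality {x : X} {b : Y} (hx : x ∈ Df) (hAx : A x = b)
    (ys : Y →L[ℝ] ℝ) : ((ys b : ℝ) : EReal) - fenchelConj Df f (ys.comp A) ≤ (f x : EReal) := by
  refine EReal.sub_le_of_le_add ?_
  have h := fenchel_young (f := f) hx (ys.comp A)
  simpa only [ContinuousLinearMap.comp_apply, hAx] using h

end Duality

section PolarCone

/-! ### Polar cones (p. 136), Corollary 4.4.5, Exercises 4.4.10 and 4.4.11 (i) -/

/-- The (negative) **polar cone** `K° = {x* ∈ X* | ⟨x*, x⟩ ≤ 0 for all x ∈ K}`.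
[cite: BorweinZhu2005, §4.4.4 p. 136] -/
def negPolarCone (K : Set X) : Set (X →L[ℝ] ℝ) := {xs | ∀ x ∈ K, xs x ≤ 0}

variable {K H : Set X} {xs : X →L[ℝ] ℝ}

/-- Membership in the polar cone. [cite: BorweinZhu2005, §4.4.4 p. 136] -/
theorem mem_negPolarCone_iff : xs ∈ negPolarCone K ↔ ∀ x ∈ K, xs x ≤ 0 := Iff.rfl

/-- `0 ∈ K°`. [cite: BorweinZhu2005, §4.4.4 p. 136] -/
theorem zero_mem_negPolarCone (K : Set X) : (0 : X →L[ℝ] ℝ) ∈ negPolarCone K :=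
  fun _ _ => le_rfl

/-- `K°` is a cone. [cite: BorweinZhu2005, §4.4.4 p. 136] -/
theorem smul_mem_negPolarCone (hxs : xs ∈ negPolarCone K) {t : ℝ} (ht : 0 ≤ t) :
    t • xs ∈ negPolarCone K := fun x hx => by
  simpa only [smul_apply, smul_eq_mul] using
    mul_nonpos_of_nonneg_of_nonpos ht (hxs x hx)

/-- `K°` is closed under addition. [cite: BorweinZhu2005, §4.4.4 p. 136] -/
theorem add_mem_negPolarCone {ys : X →L[ℝ] ℝ} (hxs : xs ∈ negPolarCone K)
    (hys : ys ∈ negPolarCone K) : xs + ys ∈ negPolarCone K := fun x hx => by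
  simpa only [add_apply] using add_nonpos (hxs x hx) (hys x hx)

/-- `K°` is a convex cone. [cite: BorweinZhu2005, §4.4.4 p. 136] -/
theorem convex_negPolarCone (K : Set X) : Convex ℝ (negPolarCone K) :=
  fun _ h₁ _ h₂ _ _ ha hb _ =>
    add_mem_negPolarCone (smul_mem_negPolarCone h₁ ha) (smul_mem_negPolarCone h₂ hb)

/-- `K°` is closed. [cite: BorweinZhu2005, §4.4.4 p. 136] -/
theorem isClosed_negPolarCone (K : Set X) : IsClosed (negPolarCone K) := by
  have : negPolarCone K = ⋂ x ∈ K, {xs : X →L[ℝ] ℝ | xs x ≤ 0} := by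
    ext xs; simp [negPolarCone]
  rw [this]
  exact isClosed_biInter fun x _ => isClosed_le (continuous_eval_const x) continuous_const

/-- The normal cone is a polar cone: `N(C; x) = (C − x)°` (with `N(C; x) = ∂ι_C(x)` as in §4.2.1,
i.e. `{x* | ⟨x*, y − x⟩ ≤ 0 ∀ y ∈ C}`). [cite: BorweinZhu2005, §4.4.4 p. 136] -/
theorem setOf_normal_eq_negPolarCone (C : Set X) (x : X) :
    {xs : X →L[ℝ] ℝ | ∀ y ∈ C, xs (y - x) ≤ 0} = negPolarCone ((fun y => y - x) '' C) := by
  ext xs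
  simp only [mem_setOf_eq, negPolarCone, mem_image, forall_exists_index, and_imp,
    forall_apply_eq_imp_iff₂]

/-- **Corollary 4.4.5**, the inclusion `K° + A*H° ⊆ (K ∩ A⁻¹H)°`, elementwise.
[cite: BorweinZhu2005, Cor 4.4.5 p. 137] -/
theorem add_comp_mem_negPolarCone_inter {A : X →L[ℝ] Y} {H : Set Y} {ys : Y →L[ℝ] ℝ}
    (hxs : xs ∈ negPolarCone K) (hys : ys ∈ negPolarCone H) :
    xs + ys.comp A ∈ negPolarCone (K ∩ A ⁻¹' H) := fun x hx => by
  simpa only [add_apply, ContinuousLinearMap.comp_apply] using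
    add_nonpos (hxs x hx.1) (hys (A x) hx.2)

/-- **Corollary 4.4.5**: `K° + A*H° ⊆ (K ∩ A⁻¹H)°`. [cite: BorweinZhu2005, Cor 4.4.5 p. 137] -/
theorem negPolarCone_add_image_subset (K : Set X) (A : X →L[ℝ] Y) (H : Set Y) :
    negPolarCone K + (fun ys : Y →L[ℝ] ℝ => ys.comp A) '' negPolarCone H ⊆
      negPolarCone (K ∩ A ⁻¹' H) := by
  rintro _ ⟨xs, hxs, _, ⟨ys, hys, rfl⟩, rfl⟩
  exact add_comp_mem_negPolarCone_inter hxs hys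

/-- **Exercise 4.4.11 (i)**: for cones `H, K` (containing `0`), `(H + K)° = H° ∩ K°`.
[cite: BorweinZhu2005, Exercise 4.4.11 (i) p. 140] -/
theorem negPolarCone_add (hH : (0 : X) ∈ H) (hK : (0 : X) ∈ K) :
    negPolarCone (H + K) = negPolarCone H ∩ negPolarCone K := by
  ext xs
  simp only [mem_inter_iff, negPolarCone, mem_setOf_eq]
  constructor
  · intro h
    exact ⟨fun x hx => by simpa using h (x + 0) (add_mem_add hx hK),
      fun x hx => by simpa using h (0 + x) (add_mem_add hH hx)⟩
  · rintro ⟨h₁, h₂⟩ _ ⟨x, hx, y, hy, rfl⟩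
    rw [map_add]; exact add_nonpos (h₁ x hx) (h₂ y hy)

end PolarCone

section Indicator

/-! ### Conjugates of indicator functions: Exercise 4.4.6 (`ι_C* = σ_C`, `ι_C** = ι_C`) and
Exercise 4.4.10 (`ι_K* = ι_{K°}`) -/

variable {C K : Set X} {xs : X →L[ℝ] ℝ} {x : X}

/-- **Exercise 4.4.6**: `ι_C* = σ_C`, the support function `σ_C(x*) = sup_{x ∈ C} ⟨x*, x⟩`.
[cite: BorweinZhu2005, Exercise 4.4.6 p. 139] -/
theorem fenchelConj_indicator (C : Set X) (xs : X →L[ℝ] ℝ) :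
    fenchelConj C (fun _ => 0) xs = ⨆ x ∈ C, ((xs x : ℝ) : EReal) := by
  simp only [fenchelConj, sub_zero]

/-- **Exercise 4.4.6**: `ι_C**(x) = 0 = ι_C(x)` for `x ∈ C`.
[cite: BorweinZhu2005, Exercise 4.4.6 p. 139] -/
theorem fenchelBiconj_indicator_of_mem (hx : x ∈ C) : fenchelBiconj C (fun _ => 0) x = 0 := by
  apply le_antisymm
  · simpa using fenchelBiconj_le (f := fun _ => (0 : ℝ)) hx
  · refine le_trans (le_of_eq ?_) (le_fenchelBiconj (0 : X →L[ℝ] ℝ) x)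
    have h0 : fenchelConj C (fun _ => (0 : ℝ)) (0 : X →L[ℝ] ℝ) =
        (((0 : X →L[ℝ] ℝ) x - 0 : ℝ) : EReal) :=
      fenchelConj_eq_coe_of_mem hx fun y _ => by simp
    rw [h0]; simp

/-- **Exercise 4.4.6**: `ι_C**(x) = +∞ = ι_C(x)` for `x ∉ C`, `C` closed and convex (Hahn–Banach
separation). [cite: BorweinZhu2005, Exercise 4.4.6 p. 139] -/
theorem fenchelBiconj_indicator_of_not_mem (hC₁ : Convex ℝ C) (hC₂ : IsClosed C) (hx : x ∉ C) :
    fenchelBiconj C (fun _ => 0) x = ⊤ := by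
  rcases C.eq_empty_or_nonempty with rfl | hne
  · -- `ι_∅* ≡ −∞`, so every term of the supremum is `+∞`
    refine eq_top_iff.2 (le_trans (le_of_eq ?_) (le_fenchelBiconj (0 : X →L[ℝ] ℝ) x))
    rw [fenchelConj_empty, EReal.coe_sub_bot]
  obtain ⟨φ, u, hφ, hu⟩ := geometric_hahn_banach_closed_point hC₁ hC₂ hx
  refine (EReal.eq_top_iff_forall_lt _).2 fun r => ?_
  have hgap : 0 < φ x - u := by linarith
  set t : ℝ := (|r| + 1) / (φ x - u) with ht
  have htpos : 0 < t := div_pos (by positivity) hgap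
  -- the conjugate of `ι_C` at `t • φ` is at most `t u`
  have hconj : fenchelConj C (fun _ => (0 : ℝ)) (t • φ) ≤ ((t * u : ℝ) : EReal) := by
    refine fenchelConj_le_coe_iff.2 fun a ha => ?_
    simp only [smul_apply, smul_eq_mul, sub_zero]
    exact mul_le_mul_of_nonneg_left (hφ a ha).le htpos.le
  have hterm : ((t * (φ x - u) : ℝ) : EReal) ≤
      (((t • φ) x : ℝ) : EReal) - fenchelConj C (fun _ => (0 : ℝ)) (t • φ) := by
    have e : ((t * (φ x - u) : ℝ) : EReal) = (((t • φ) x : ℝ) : EReal) - ((t * u : ℝ) : EReal) := by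
      rw [← EReal.coe_sub]; congr 1
      simp only [smul_apply, smul_eq_mul]; ring
    rw [e]
    exact EReal.sub_le_sub le_rfl hconj
  refine lt_of_lt_of_le ?_ (le_trans hterm (le_fenchelBiconj (t • φ) x))
  rw [EReal.coe_lt_coe_iff, ht, div_mul_cancel₀ _ hgap.ne']
  linarith [le_abs_self r]

/-- **Exercise 4.4.10**: for a cone `K`, `ι_K* = ι_{K°}`: the conjugate vanishes on `K°` …
[cite: BorweinZhu2005, Exercise 4.4.10 p. 139] -/
theorem fenchelConj_indicator_cone_of_mem (h0 : (0 : X) ∈ K) (hxs : xs ∈ negPolarCone K) :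
    fenchelConj K (fun _ => 0) xs = 0 := by
  have h := fenchelConj_eq_coe_of_mem (f := fun _ => (0 : ℝ)) (xs := xs) h0 fun y hy => by
    simpa using hxs y hy
  simpa using h

/-- **Exercise 4.4.10**: … and is `+∞` off `K°` (for `K` closed under positive scaling).
[cite: BorweinZhu2005, Exercise 4.4.10 p. 139] -/
theorem fenchelConj_indicator_cone_of_not_mem (hK : ∀ x ∈ K, ∀ t : ℝ, 0 < t → t • x ∈ K)
    (hxs : xs ∉ negPolarCone K) : fenchelConj K (fun _ => 0) xs = ⊤ := by
  simp only [negPolarCone, mem_setOf_eq, not_forall, not_le, exists_prop] at hxs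
  obtain ⟨x, hx, hpos⟩ := hxs
  refine fenchelConj_eq_top_iff.2 fun r => ?_
  refine ⟨((|r| + 1) / xs x) • x, hK x hx _ (div_pos (by positivity) hpos), ?_⟩
  rw [map_smul, smul_eq_mul, sub_zero, div_mul_cancel₀ _ hpos.ne']
  linarith [le_abs_self r]

end Indicator

section Concave

/-! ### Exercise 4.4.9: the concave conjugate and symmetric weak duality -/

variable {Df Dg : Set X} {f g : X → ℝ} {x : X}

/-- The **concave conjugate** `g_*(x*) = inf_{x ∈ dom g} {⟨x*, x⟩ − g(x)}`.
[cite: BorweinZhu2005, Exercise 4.4.9 p. 139] -/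
noncomputable def concaveConj (D : Set X) (g : X → ℝ) (xs : X →L[ℝ] ℝ) : EReal :=
  ⨅ x ∈ D, ((xs x - g x : ℝ) : EReal)

/-- `g_*(x*) ≤ ⟨x*, x⟩ − g(x)` for `x ∈ dom g`. [cite: BorweinZhu2005, Exercise 4.4.9 p. 139] -/
theorem concaveConj_le (xs : X →L[ℝ] ℝ) (hx : x ∈ Dg) :
    concaveConj Dg g xs ≤ ((xs x - g x : ℝ) : EReal) :=
  iInf₂_le (f := fun x (_ : x ∈ Dg) => ((xs x - g x : ℝ) : EReal)) x hx

/-- **Exercise 4.4.9 (symmetric Fenchel duality), weak inequality**: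
`inf (f − g) ≥ sup (g_* − f*)`, pointwise. [cite: BorweinZhu2005, Exercise 4.4.9 p. 139] -/
theorem concaveConj_sub_fenchelConj_le (hxf : x ∈ Df) (hxg : x ∈ Dg) (xs : X →L[ℝ] ℝ) :
    concaveConj Dg g xs - fenchelConj Df f xs ≤ ((f x - g x : ℝ) : EReal) := by
  calc concaveConj Dg g xs - fenchelConj Df f xs
      ≤ ((xs x - g x : ℝ) : EReal) - ((xs x - f x : ℝ) : EReal) :=
        EReal.sub_le_sub (concaveConj_le xs hxg) (le_fenchelConj xs hxf)
    _ = ((f x - g x : ℝ) : EReal) := by rw [← EReal.coe_sub]; congr 1; ring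

end Concave

section RealLine

/-! ### Conjugate pairs of convex functions on `ℝ`: Tables 4.1 and 4.2 (Exercise 4.4.2) -/

/-- The Fenchel conjugate of a function on `ℝ` (effective domain `D`), with `ℝ* = ℝ` and the
pairing `⟨y, x⟩ = x y`: `f*(y) = sup_{x ∈ D} (x y − f(x))`.
[cite: BorweinZhu2005, §4.4.1 p. 134; Table 4.1 p. 138] -/
noncomputable def realFenchelConj (D : Set ℝ) (f : ℝ → ℝ) (y : ℝ) : EReal :=
  ⨆ x ∈ D, ((x * y - f x : ℝ) : EReal)

variable {D : Set ℝ} {f h : ℝ → ℝ} {x y c : ℝ}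

/-- On `X = ℝ` (where `x* (x) = x · x*(1)`), `fenchelConj` is `realFenchelConj` at `x*(1)`.
[cite: BorweinZhu2005, §4.4.1 p. 134] -/
theorem fenchelConj_eq_realFenchelConj (D : Set ℝ) (f : ℝ → ℝ) (xs : ℝ →L[ℝ] ℝ) :
    fenchelConj D f xs = realFenchelConj D f (xs 1) := by
  set c := xs 1 with hc
  have e : ∀ x : ℝ, xs x = x * c := fun x => by
    rw [hc]; simpa using map_smul xs x (1 : ℝ)
  unfold fenchelConj realFenchelConj
  simp_rw [e]

/-- Each `x y − f(x)`, `x ∈ D`, lies below `f*(y)`. [cite: BorweinZhu2005, §4.4.1 p. 134] -/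
theorem le_realFenchelConj (y : ℝ) (hx : x ∈ D) :
    ((x * y - f x : ℝ) : EReal) ≤ realFenchelConj D f y :=
  le_iSup₂ (f := fun x (_ : x ∈ D) => ((x * y - f x : ℝ) : EReal)) x hx

/-- `f*(y) ≤ C` iff `C` bounds every `x y − f(x)`. [cite: BorweinZhu2005, §4.4.1 p. 134] -/
theorem realFenchelConj_le_iff {C : EReal} :
    realFenchelConj D f y ≤ C ↔ ∀ x ∈ D, ((x * y - f x : ℝ) : EReal) ≤ C :=
  iSup₂_le_iff

/-- Real upper bounds of `f*(y)`. [cite: BorweinZhu2005, §4.4.1 p. 134] -/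
theorem realFenchelConj_le_coe_iff :
    realFenchelConj D f y ≤ (c : EReal) ↔ ∀ x ∈ D, x * y - f x ≤ c := by
  simp only [realFenchelConj_le_iff, EReal.coe_le_coe_iff]

/-- Real strict lower bounds of `f*(y)`. [cite: BorweinZhu2005, §4.4.1 p. 134] -/
theorem coe_lt_realFenchelConj_iff :
    (c : EReal) < realFenchelConj D f y ↔ ∃ x ∈ D, c < x * y - f x := by
  simp only [realFenchelConj, lt_biSup_iff, EReal.coe_lt_coe_iff]

/-- `f*(y) = +∞` iff the values `x y − f(x)` are unbounded above.
[cite: BorweinZhu2005, §4.4.1 p. 134] -/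
theorem realFenchelConj_eq_top_iff :
    realFenchelConj D f y = ⊤ ↔ ∀ r : ℝ, ∃ x ∈ D, r < x * y - f x := by
  simp only [EReal.eq_top_iff_forall_lt, coe_lt_realFenchelConj_iff]

/-- An attained supremum: `f*(y) = x y − f(x)`. [cite: BorweinZhu2005, §4.4.1 p. 134] -/
theorem realFenchelConj_eq_coe_of_mem (hx : x ∈ D) (hmax : ∀ z ∈ D, z * y - f z ≤ x * y - f x) :
    realFenchelConj D f y = ((x * y - f x : ℝ) : EReal) :=
  le_antisymm (realFenchelConj_le_coe_iff.2 hmax) (le_realFenchelConj y hx)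

/-- A (possibly non-attained) real supremum: `f*(y) = c`. [cite: BorweinZhu2005, §4.4.1 p. 134] -/
theorem realFenchelConj_eq_coe (hle : ∀ x ∈ D, x * y - f x ≤ c)
    (hlt : ∀ r < c, ∃ x ∈ D, r < x * y - f x) : realFenchelConj D f y = (c : EReal) := by
  refine le_antisymm (realFenchelConj_le_coe_iff.2 hle)
    (EReal.ge_of_forall_gt_iff_ge.1 fun r hr => ?_)
  exact (coe_lt_realFenchelConj_iff.2 (hlt r (EReal.coe_lt_coe_iff.1 hr))).le

/-- **Table 4.1, row 1**: `f = 0` on `ℝ` has conjugate `ι_{0}` (`0` at `y = 0`, `+∞` elsewhere).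
[cite: BorweinZhu2005, Table 4.1 p. 138] -/
theorem realFenchelConj_zero_univ (y : ℝ) :
    realFenchelConj univ (fun _ => 0) y = if y = 0 then 0 else ⊤ := by
  split_ifs with hy
  · rw [realFenchelConj_eq_coe_of_mem (x := 0) (mem_univ _) fun z _ => by simp [hy]]
    simp [hy]
  · refine realFenchelConj_eq_top_iff.2 fun r => ⟨(|r| + 1) / y, mem_univ _, ?_⟩
    rw [div_mul_cancel₀ _ hy, sub_zero]
    linarith [le_abs_self r]

/-- **Table 4.1, row 2**: `f = 0` on `ℝ₊` has conjugate `ι_{−ℝ₊}`.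
[cite: BorweinZhu2005, Table 4.1 p. 138] -/
theorem realFenchelConj_zero_Ici (y : ℝ) :
    realFenchelConj (Ici 0) (fun _ => 0) y = if y ≤ 0 then 0 else ⊤ := by
  split_ifs with hy
  · rw [realFenchelConj_eq_coe_of_mem (x := 0) (mem_Ici.2 le_rfl) fun z hz => by
      simpa using mul_nonpos_of_nonneg_of_nonpos (mem_Ici.1 hz) hy]
    simp
  · push Not at hy
    refine realFenchelConj_eq_top_iff.2 fun r => ⟨(|r| + 1) / y, ?_, ?_⟩
    · exact mem_Ici.2 (div_nonneg (by positivity) hy.le)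
    · rw [div_mul_cancel₀ _ hy.ne', sub_zero]
      linarith [le_abs_self r]

/-- **Table 4.1, row 3**: `f = 0` on `[−1, 1]` has conjugate `|y|`.
[cite: BorweinZhu2005, Table 4.1 p. 138] -/
theorem realFenchelConj_zero_Icc (y : ℝ) :
    realFenchelConj (Icc (-1) 1) (fun _ => 0) y = ((|y| : ℝ) : EReal) := by
  refine realFenchelConj_eq_coe (fun x hx => ?_) (fun r hr => ?_)
  · rw [sub_zero]
    calc x * y ≤ |x * y| := le_abs_self _
      _ = |x| * |y| := abs_mul x y
      _ ≤ 1 * |y| := mul_le_mul_of_nonneg_right (abs_le.2 (mem_Icc.1 hx)) (abs_nonneg y)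
      _ = |y| := one_mul _
  · rcases le_or_gt 0 y with hy | hy
    · exact ⟨1, by simp, by rw [abs_of_nonneg hy] at hr; linarith⟩
    · exact ⟨-1, by simp, by rw [abs_of_neg hy] at hr; linarith⟩

/-- **Table 4.1, row 4**: `f = 0` on `[0, 1]` has conjugate `y⁺`.
[cite: BorweinZhu2005, Table 4.1 p. 138] -/
theorem realFenchelConj_zero_unitIcc (y : ℝ) :
    realFenchelConj (Icc 0 1) (fun _ => 0) y = ((max y 0 : ℝ) : EReal) := by
  refine realFenchelConj_eq_coe (fun x hx => ?_) (fun r hr => ?_)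
  · obtain ⟨hx0, hx1⟩ := mem_Icc.1 hx
    rw [sub_zero]
    calc x * y ≤ x * max y 0 := mul_le_mul_of_nonneg_left (le_max_left y 0) hx0
      _ ≤ max y 0 := mul_le_of_le_one_left (le_max_right y 0) hx1
  · rcases le_or_gt 0 y with hy | hy
    · exact ⟨1, by simp, by rw [max_eq_left hy] at hr; linarith⟩
    · exact ⟨0, by simp, by rw [max_eq_right hy.le] at hr; linarith⟩

/-- For `a ≥ 0` and conjugate exponents: `a^{q−1} · a = a^q` and `(a^{q−1})^p = a^q`. [folklore] -/
private theorem rpow_conj_aux {p q : ℝ} (hpq : p.HolderConjugate q) {a : ℝ} (ha : 0 ≤ a) :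
    a ^ (q - 1) * a = a ^ q ∧ (a ^ (q - 1)) ^ p = a ^ q := by
  constructor
  · rw [← Real.rpow_add_one' ha (by rw [sub_add_cancel]; exact hpq.symm.ne_zero), sub_add_cancel]
  · rw [← Real.rpow_mul ha, hpq.symm.sub_one_mul_conj]

/-- **Table 4.1, row 5**: `|x|^p / p` on `ℝ` (`1 < p`) has conjugate `|y|^q / q`, `1/p + 1/q = 1`
(Young's inequality with its equality case). [cite: BorweinZhu2005, Table 4.1 p. 138] -/
theorem realFenchelConj_abs_rpow {p q : ℝ} (hpq : p.HolderConjugate q) (y : ℝ) :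
    realFenchelConj univ (fun x => |x| ^ p / p) y = ((|y| ^ q / q : ℝ) : EReal) := by
  have hval : ∀ {a : ℝ}, 0 ≤ a → a ^ (q - 1) * a - |a ^ (q - 1)| ^ p / p = a ^ q / q := by
    intro a ha
    obtain ⟨h1, h2⟩ := rpow_conj_aux hpq ha
    rw [abs_of_nonneg (Real.rpow_nonneg ha _), h1, h2, div_eq_mul_inv, div_eq_mul_inv]
    have hq : q⁻¹ = 1 - p⁻¹ := by linarith [hpq.inv_add_inv_eq_one]
    rw [hq]
    ring
  refine realFenchelConj_eq_coe (fun x _ => ?_) (fun r hr => ?_)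
  · linarith [Real.young_inequality x y hpq]
  · rcases le_or_gt 0 y with hy | hy
    · refine ⟨y ^ (q - 1), mem_univ _, ?_⟩
      rw [hval hy]; rwa [abs_of_nonneg hy] at hr
    · refine ⟨-((-y) ^ (q - 1)), mem_univ _, ?_⟩
      have h := hval (neg_nonneg.2 hy.le)
      rw [abs_neg, show -(-y) ^ (q - 1) * y = (-y) ^ (q - 1) * (-y) by ring, h]
      rwa [abs_of_neg hy] at hr

/-- `y (1 + (x − log y)) ≤ eˣ` for `y > 0` (tangency of `eˣ` and its chords). [folklore] -/
private theorem mul_one_add_sub_log_le_exp {y : ℝ} (hy : 0 < y) (x : ℝ) :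
    y * (1 + (x - Real.log y)) ≤ Real.exp x := by
  have h : Real.exp x = y * Real.exp (x - Real.log y) := by
    rw [Real.exp_sub, Real.exp_log hy]; field_simp
  rw [h]
  exact mul_le_mul_of_nonneg_left (by linarith [Real.add_one_le_exp (x - Real.log y)]) hy.le

/-- **Table 4.1, row 8**: `−log x` on `int ℝ₊` has conjugate `−1 − log(−y)` on `−int ℝ₊`
(`+∞` for `y ≥ 0`). [cite: BorweinZhu2005, Table 4.1 p. 138] -/
theorem realFenchelConj_neg_log (y : ℝ) :
    realFenchelConj (Ioi 0) (fun x => -Real.log x) y =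
      if y < 0 then (((-1 - Real.log (-y)) : ℝ) : EReal) else ⊤ := by
  split_ifs with hy
  · have hy0 : y ≠ 0 := hy.ne
    have hx₀ : (0 : ℝ) < -1 / y := div_pos_of_neg_of_neg (by norm_num) hy
    rw [realFenchelConj_eq_coe_of_mem (D := Ioi 0) (f := fun x => -Real.log x) (x := -1 / y) hx₀
      fun z hz => ?_]
    · have h2 : -1 / y * y = -1 := div_mul_cancel₀ _ hy0
      rw [h2, show -1 / y = (-y)⁻¹ by rw [inv_neg, inv_eq_one_div, neg_div], Real.log_inv]
      congr 1; ring
    · have hz0 : (0 : ℝ) < z := hz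
      have hu : 0 < z * -y := mul_pos hz0 (neg_pos.2 hy)
      have hlog : Real.log (z * -y) = Real.log z + Real.log (-y) :=
        Real.log_mul hz0.ne' (by linarith)
      have h1 := Real.log_le_sub_one_of_pos hu
      have h2 : -1 / y * y = -1 := div_mul_cancel₀ _ hy0
      rw [h2, show -1 / y = (-y)⁻¹ by rw [inv_neg, inv_eq_one_div, neg_div], Real.log_inv]
      linarith
  · push Not at hy
    refine realFenchelConj_eq_top_iff.2 fun r => ⟨Real.exp (|r| + 1), Real.exp_pos _, ?_⟩
    rw [Real.log_exp, sub_neg_eq_add]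
    nlinarith [le_abs_self r, (Real.exp_pos (|r| + 1)).le]

/-- **Table 4.1, row 9**: `eˣ` on `ℝ` has conjugate `y log y − y` (`y > 0`), `0` (`y = 0`), `+∞`
(`y < 0`).
[cite: BorweinZhu2005, Table 4.1 p. 138; index "Fenchel conjugate of exponential" p. 137] -/
theorem realFenchelConj_exp (y : ℝ) :
    realFenchelConj univ Real.exp y =
      if 0 < y then ((y * Real.log y - y : ℝ) : EReal) else if y = 0 then 0 else ⊤ := by
  split_ifs with hy hy0
  · rw [realFenchelConj_eq_coe_of_mem (x := Real.log y) (mem_univ _) fun z _ => by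
      rw [Real.exp_log hy]; linarith [mul_one_add_sub_log_le_exp hy z]]
    rw [Real.exp_log hy]; congr 1; ring
  · subst hy0
    refine realFenchelConj_eq_coe (fun x _ => by simpa using (Real.exp_pos x).le) (fun r hr => ?_)
    refine ⟨Real.log (-r / 2), mem_univ _, ?_⟩
    rw [mul_zero, zero_sub, Real.exp_log (by linarith)]
    linarith
  · have hy' : y < 0 := lt_of_le_of_ne (not_lt.1 hy) hy0
    refine realFenchelConj_eq_top_iff.2 fun r => ?_
    set t : ℝ := (|r| + 1) / (-y) with ht
    have htpos : 0 < t := div_pos (by positivity) (neg_pos.2 hy')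
    refine ⟨-t, mem_univ _, ?_⟩
    have h1 : -t * y = |r| + 1 := by rw [ht]; field_simp
    have h2 : Real.exp (-t) < 1 := Real.exp_lt_one_iff.2 (by linarith)
    rw [h1]; linarith [le_abs_self r]

/-- **Table 4.1, row 9, `f = f**`** (Exercise 4.4.2): the conjugate of `y log y − y` on `ℝ₊` is
`eˣ`. [cite: BorweinZhu2005, Table 4.1 p. 138; Exercise 4.4.2 p. 137] -/
theorem realFenchelConj_mul_log_sub (x : ℝ) :
    realFenchelConj (Ici 0) (fun y => y * Real.log y - y) x = ((Real.exp x : ℝ) : EReal) := by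
  rw [realFenchelConj_eq_coe_of_mem (x := Real.exp x) (mem_Ici.2 (Real.exp_pos x).le)
    fun z hz => ?_]
  · rw [Real.log_exp]; congr 1; ring
  · rw [Real.log_exp]
    rcases (mem_Ici.1 hz).eq_or_lt with rfl | hz0
    · simp; nlinarith [Real.exp_pos x]
    · nlinarith [mul_one_add_sub_log_le_exp hz0 x]

/-- **Table 4.1, row 3, `f = f**`** (Exercise 4.4.2): the conjugate of `|y|` on `ℝ` is `ι_[−1,1]`.
[cite: BorweinZhu2005, Table 4.1 p. 138; Exercise 4.4.2 p. 137] -/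
theorem realFenchelConj_abs (y : ℝ) :
    realFenchelConj univ (fun x => |x|) y = if |y| ≤ 1 then 0 else ⊤ := by
  split_ifs with hy
  · rw [realFenchelConj_eq_coe_of_mem (x := 0) (mem_univ _) fun z _ => ?_]
    · simp
    · have : z * y ≤ |z| * 1 :=
        (le_abs_self _).trans (by rw [abs_mul]; exact mul_le_mul_of_nonneg_left hy (abs_nonneg z))
      simp; linarith
  · push Not at hy
    refine realFenchelConj_eq_top_iff.2 fun r => ?_
    rcases le_or_gt 0 y with hy0 | hy0
    · rw [abs_of_nonneg hy0] at hy
      refine ⟨(|r| + 1) / (y - 1), mem_univ _, ?_⟩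
      have hpos : 0 < (|r| + 1) / (y - 1) := div_pos (by positivity) (by linarith)
      rw [abs_of_pos hpos]
      have : (|r| + 1) / (y - 1) * y - (|r| + 1) / (y - 1) = |r| + 1 := by field_simp
      rw [this]; linarith [le_abs_self r]
    · rw [abs_of_neg hy0] at hy
      refine ⟨-((|r| + 1) / (-y - 1)), mem_univ _, ?_⟩
      have hpos : 0 < (|r| + 1) / (-y - 1) := div_pos (by positivity) (by linarith)
      rw [abs_neg, abs_of_pos hpos]
      have : -((|r| + 1) / (-y - 1)) * y - (|r| + 1) / (-y - 1) = |r| + 1 := by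
        field_simp
      rw [this]; linarith [le_abs_self r]

/-- **Table 4.2, row 1**: the conjugate of `x ↦ h(a x)` (`a ≠ 0`) is `y ↦ h*(y / a)`.
[cite: BorweinZhu2005, Table 4.2 p. 138] -/
theorem realFenchelConj_comp_mul {a : ℝ} (ha : a ≠ 0) (y : ℝ) :
    realFenchelConj {x | a * x ∈ D} (fun x => h (a * x)) y = realFenchelConj D h (y / a) := by
  apply le_antisymm
  · refine realFenchelConj_le_iff.2 fun x hx => ?_
    have e : x * y - h (a * x) = (a * x) * (y / a) - h (a * x) := by field_simp
    rw [e]; exact le_realFenchelConj (y / a) hx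
  · refine realFenchelConj_le_iff.2 fun z hz => ?_
    have hz' : a * (z / a) ∈ D := by rwa [mul_div_cancel₀ z ha]
    have e : z * (y / a) - h z = (z / a) * y - h (a * (z / a)) := by
      rw [mul_div_cancel₀ z ha]; field_simp
    rw [e]; exact le_realFenchelConj (f := fun x => h (a * x)) y hz'

/-- **Table 4.2, row 2**: the conjugate of `x ↦ h(x + b)` is `y ↦ h*(y) − b y`.
[cite: BorweinZhu2005, Table 4.2 p. 138] -/
theorem realFenchelConj_comp_add (b y : ℝ) :
    realFenchelConj {x | x + b ∈ D} (fun x => h (x + b)) y =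
      realFenchelConj D h y - ((b * y : ℝ) : EReal) := by
  apply le_antisymm
  · refine realFenchelConj_le_iff.2 fun x hx => ?_
    have e : ((x * y - h (x + b) : ℝ) : EReal) =
        (((x + b) * y - h (x + b) : ℝ) : EReal) - ((b * y : ℝ) : EReal) := by
      rw [← EReal.coe_sub]; congr 1; ring
    rw [e]; exact EReal.sub_le_sub (le_realFenchelConj y hx) le_rfl
  · refine EReal.sub_le_of_le_add (realFenchelConj_le_iff.2 fun z hz => ?_)
    have hz' : z - b + b ∈ D := by rwa [sub_add_cancel]
    have e : ((z * y - h z : ℝ) : EReal) =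
        (((z - b) * y - h (z - b + b) : ℝ) : EReal) + ((b * y : ℝ) : EReal) := by
      rw [← EReal.coe_add, sub_add_cancel]; congr 1; ring
    rw [e]; exact add_le_add (le_realFenchelConj (f := fun x => h (x + b)) y hz') le_rfl

/-- Multiplication by a positive real is an order automorphism of `[−∞, +∞]`. [folklore] -/
private noncomputable def mulLeftOrderIso (a : ℝ) (ha : 0 < a) : EReal ≃o EReal where
  toFun z := (a : EReal) * z
  invFun z := ((a⁻¹ : ℝ) : EReal) * z
  left_inv z := by
    simp only
    rw [← mul_assoc, ← EReal.coe_mul, inv_mul_cancel₀ ha.ne', EReal.coe_one, one_mul]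
  right_inv z := by
    simp only
    rw [← mul_assoc, ← EReal.coe_mul, mul_inv_cancel₀ ha.ne', EReal.coe_one, one_mul]
  map_rel_iff' := by
    intro z w
    simp only [Equiv.coe_fn_mk]
    constructor
    · intro hzw
      have h := mul_le_mul_of_nonneg_left hzw (EReal.coe_nonneg.2 (inv_nonneg.2 ha.le))
      rwa [← mul_assoc, ← mul_assoc, ← EReal.coe_mul, inv_mul_cancel₀ ha.ne', EReal.coe_one,
        one_mul, one_mul] at h
    · intro hzw
      exact mul_le_mul_of_nonneg_left hzw (EReal.coe_nonneg.2 ha.le)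

/-- **Table 4.2, row 3**: the conjugate of `x ↦ a h(x)` (`a > 0`) is `y ↦ a h*(y / a)`.
[cite: BorweinZhu2005, Table 4.2 p. 138] -/
theorem realFenchelConj_const_mul {a : ℝ} (ha : 0 < a) (y : ℝ) :
    realFenchelConj D (fun x => a * h x) y = (a : EReal) * realFenchelConj D h (y / a) := by
  have e : (a : EReal) * realFenchelConj D h (y / a) =
      mulLeftOrderIso a ha (realFenchelConj D h (y / a)) := rfl
  rw [e]
  unfold realFenchelConj
  simp_rw [OrderIso.map_iSup]
  refine iSup_congr fun z => iSup_congr fun _ => ?_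
  show ((z * y - a * h z : ℝ) : EReal) = (a : EReal) * ((z * (y / a) - h z : ℝ) : EReal)
  rw [← EReal.coe_mul]; congr 1
  field_simp

end RealLine

end Literature.Analysis.Convex.FenchelConjugate
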